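import Literature.NumberTheory.EllipticCurves.BinaryQuarticDiscriminantLiftProofs
import HarnessLib

/-!
# `W_p^{(2)}` in a box: for fixed `a, b, c, d ∈ ℤ`, the `e` in an interval of length `L` with
# `p² ∣ Δ` and `p ∤ ∂Δ/∂e` number at most `3(L/p² + 1)`

`Proofs` companion (theorems only) of `BinaryQuarticDiscriminantLiftProofs.lean`, giving the
integer form of the count in the proof of Thm 2.20 of M. Bhargava, A. Shankar, *Binary quartic
forms having bounded invariants, and the boundedness of the average rank of elliptic curves*, Ann.
of Math. (2) 181 (2015) 191–242 (published version = arXiv:1006.1002v3, §2.6): "Given fixed values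
of `a₀`, `b₀`, `c₀`, and `d₀`, there are at most `3` choices for the residue of `e₀` (mod `p`) such
that `p ∣ Δ`. Since `p ∤ ∂Δ/∂e`, each such residue modulo `p` has a unique lift modulo `p²` such
that `p² ∣ Δ`. Hence, we have `#{R_X^{(ε)} ∩ W_p^{(2)}(V)} = O(max{X^{5/6}/p², X^{4/6}})`" — the
last step being: `O(X^{4/6})` quadruples `(a₀, b₀, c₀, d₀)`, and for each of them the admissible
`e₀` range over an interval of length `O(X^{1/6})` and lie in `≤ 3` residue classes modulo `p²`.

* `card_filter_Ico_intCast_eq_le`: an interval of `L` consecutive integers meets a residue class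
  modulo `n` in at most `L/n + 1` integers;
* `card_filter_Ico_sq_dvd_disc_le`: for `p ≥ 5`, `a, b, c, d, m ∈ ℤ` and `L ∈ ℕ`,
  `#{e ∈ [m, m+L) : p² ∣ Δ(a,b,c,d,e), p ∤ ∂Δ/∂e(a,b,c,d,e)} ≤ 3·(L/p² + 1)`
  (from `card_filter_abcd_disc_eq_zero_sq_le_three`: at most `3` classes modulo `p²`).

## References

* M. Bhargava, A. Shankar, Ann. of Math. (2) 181 (2015), §2.6, proof of Thm 2.20 of the published
  version (= arXiv:1006.1002v3). [cite: BhargavaShankarAnnals2015, §2.6, proof of Thm 2.20 (published numbering)]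
-/

noncomputable section

open scoped Classical

namespace Literature.NumberTheory.EllipticCurves

namespace BinaryQuartic

open Finset

/-- **An interval of `L` consecutive integers meets each residue class modulo `n ≥ 1` in at most
`L/n + 1` integers** (the elements of `[m, m+L)` in a fixed class have distinct quotients
`(e − m)/n ∈ [0, L/n]`). [folklore] -/
theorem card_filter_Ico_intCast_eq_le {n : ℕ} (hn : 0 < n) (m : ℤ) (L : ℕ) (r : ZMod n) :
    ((Ico m (m + L)).filter fun e : ℤ => (e : ZMod n) = r).card ≤ L / n + 1 := by
  have hn' : (0 : ℤ) < n := by exact_mod_cast hn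
  have h := card_le_card_of_injOn (s := (Ico m (m + L)).filter fun e : ℤ => (e : ZMod n) = r)
    (t := range (L / n + 1)) (fun e => ((e - m) / n).toNat) (fun e he => ?_) ?_
  · simpa using h
  · simp only [coe_filter, mem_Ico, Set.mem_setOf_eq] at he
    simp only [coe_range, Set.mem_Iio]
    have h1 : (e - m) / (n : ℤ) ≤ (L : ℤ) / n := Int.ediv_le_ediv hn' (by omega)
    have h2 : ((L : ℤ) / n) = ((L / n : ℕ) : ℤ) := (Int.natCast_div L n).symm
    have h3 : 0 ≤ (e - m) / (n : ℤ) := Int.ediv_nonneg (by omega) hn'.le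
    have h4 : (0 : ℤ) ≤ (L : ℤ) / n := Int.ediv_nonneg (by positivity) hn'.le
    omega
  · intro e he e' he' hq
    simp only [coe_filter, mem_Ico, Set.mem_setOf_eq] at he he'
    simp only at hq
    have hr : (e - m) % n = (e' - m) % n :=
      ((ZMod.intCast_eq_intCast_iff _ _ n).mp (he.2.trans he'.2.symm)).sub_right m
    have hq' : (e - m) / n = (e' - m) / n := by
      have h0 : 0 ≤ (e - m) / n := Int.ediv_nonneg (by omega) hn'.le
      have h0' : 0 ≤ (e' - m) / n := Int.ediv_nonneg (by omega) hn'.le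
      omega
    have hmul : (n : ℤ) * ((e - m) / n) = (n : ℤ) * ((e' - m) / n) := by rw [hq']
    have := Int.mul_ediv_add_emod (e - m) n
    have := Int.mul_ediv_add_emod (e' - m) n
    omega

variable {p : ℕ} [hp : Fact p.Prime]

/-- **At most `3(L/p² + 1)` values of `e` in an interval of length `L`** give, for fixed integers
`a, b, c, d` and a prime `p ≥ 5`, a form with `p² ∣ Δ` and `p ∤ ∂Δ/∂e` — the count
"`#{R_X^{(ε)} ∩ W_p^{(2)}(V)} = O(max{X^{5/6}/p², X^{4/6}})`" of the proof of Thm 2.20 of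
Bhargava–Shankar 2015, per quadruple `(a₀, b₀, c₀, d₀)`: such `e` lie in at most `3` residue classes
modulo `p²` (`card_filter_abcd_disc_eq_zero_sq_le_three`), and each class meets the interval in at
most `L/p² + 1` integers. [cite: BhargavaShankarAnnals2015, §2.6, proof of Thm 2.20 (published numbering)] -/
theorem card_filter_Ico_sq_dvd_disc_le (hp5 : 5 ≤ p) (a b c d m : ℤ) (L : ℕ) :
    ((Ico m (m + L)).filter fun e : ℤ =>
        (p : ℤ) ^ 2 ∣ (⟨a, b, c, d, e⟩ : BinaryQuartic ℤ).disc ∧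
          ¬ (p : ℤ) ∣ (⟨a, b, c, d, e⟩ : BinaryQuartic ℤ).discDerivE).card ≤ 3 * (L / p ^ 2 + 1) := by
  have hp2 : 0 < p ^ 2 := pow_pos hp.out.pos 2
  -- the admissible residues of `e` modulo `p²`
  set t : Finset (ZMod (p ^ 2)) := univ.filter fun r : ZMod (p ^ 2) =>
      (⟨(a : ZMod (p ^ 2)), (b : ZMod (p ^ 2)), (c : ZMod (p ^ 2)), (d : ZMod (p ^ 2)), r⟩ :
          BinaryQuartic (ZMod (p ^ 2))).disc = 0 ∧
        ((⟨(a : ZMod (p ^ 2)), (b : ZMod (p ^ 2)), (c : ZMod (p ^ 2)), (d : ZMod (p ^ 2)), r⟩ :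
          BinaryQuartic (ZMod (p ^ 2))).map (ZMod.castHom (dvd_pow_self p two_ne_zero) (ZMod p))
          ).discDerivE ≠ 0 with ht
  have htcard : t.card ≤ 3 := by
    refine (card_le_card_of_injOn (fun r : ZMod (p ^ 2) =>
        (⟨(a : ZMod (p ^ 2)), (b : ZMod (p ^ 2)), (c : ZMod (p ^ 2)), (d : ZMod (p ^ 2)), r⟩ :
          BinaryQuartic (ZMod (p ^ 2)))) (fun r hr => ?_) (fun r _ r' _ h => ?_)).trans
      (card_filter_abcd_disc_eq_zero_sq_le_three hp5 (a : ZMod (p ^ 2)) b c d)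
    · simp only [ht, coe_filter, mem_univ, true_and, Set.mem_setOf_eq] at hr ⊢
      exact hr
    · exact congrArg BinaryQuartic.e h
  -- reduction modulo `p²` maps the `e` in question into `t`, with fibres of size `≤ L/p² + 1`
  have key := card_le_mul_card_image_of_maps_to
    (s := (Ico m (m + L)).filter fun e : ℤ =>
        (p : ℤ) ^ 2 ∣ (⟨a, b, c, d, e⟩ : BinaryQuartic ℤ).disc ∧
          ¬ (p : ℤ) ∣ (⟨a, b, c, d, e⟩ : BinaryQuartic ℤ).discDerivE)
    (t := t) (f := fun e : ℤ => (e : ZMod (p ^ 2))) (fun e he => ?_) (L / p ^ 2 + 1) (fun r _ => ?_)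
  · calc _ ≤ (L / p ^ 2 + 1) * t.card := key
      _ ≤ (L / p ^ 2 + 1) * 3 := Nat.mul_le_mul_left _ htcard
      _ = 3 * (L / p ^ 2 + 1) := Nat.mul_comm _ _
  · simp only [mem_filter] at he
    obtain ⟨-, hΔ, hΔe⟩ := he
    simp only [ht, mem_filter, mem_univ, true_and]
    constructor
    · have h1 := (sq_dvd_disc_iff_disc_map_eq_zero ⟨a, b, c, d, e⟩ p).mp hΔ
      simpa [BinaryQuartic.map] using h1
    · intro h0
      apply hΔe
      rw [← ZMod.intCast_zmod_eq_zero_iff_dvd, ← eq_intCast (Int.castRingHom (ZMod p)),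
        ← discDerivE_map]
      simpa [BinaryQuartic.map] using h0
  · exact (card_le_card (filter_subset_filter _ (filter_subset _ _))).trans
      (card_filter_Ico_intCast_eq_le hp2 m L r)

end BinaryQuartic

end Literature.NumberTheory.EllipticCurves

end
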